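import Summits.Ventures.Crystal3D.Theorems.StickyWulffConstantPolycrystalWulffBoundRungSuperTreeTextureFree
import Summits.Ventures.Crystal3D.Theorems.StickyWulffConstantPolycrystalWulffBoundRungSingleAxisCharge

/-!
# `PolycrystalWulffBound`, line `PolyDensity`: the tree-of-super-grains rung at node twin-wall charge
# `c ≥ 4/(3√6) = 0.5443` — NO azimuth test (crux `stmt-Ventures-19482`)

Route `StickyWulffConstant` of the venture `Summits/Ventures/Crystal3D`, second prover lane (poly-p2,
gen 13).  The free form `rung_superTree_texture_free` leaves the slide budget
`(1/√6)·Σ |⟪wS (nd f), ν⟫|·facetArea` explicit, with ONE slide direction per slid node.  Here every slid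
node carries the THREE horizontal `⟨112⟩` directions `wS, w₂S = (√3/2)uS − ½wS, w₃S = −(√3/2)uS − ½wS`
(each with its bond / mirror normal `uS, u₂S, u₃S`), the incident edge normals are `⊥ wS` and `⊥ uS`
(hence `⊥` all three — basal junctions about the node's axis), and the twin walls inside slid nodes are
charged `c f g ≥ 4/(3√6)`.  Choosing for EACH NODE SEPARATELY the direction with the smallest node budget
and averaging (`|⟪w,ν⟫| + |⟪w₂,ν⟫| + |⟪w₃,ν⟫| ≤ 2 sin∠(ν, mS)`, `three_dir_abs_sum_le`) gives
`6·2^{1/3}(√2·Vol)^{2/3} ≤ En n G A c m` (`rung_superTree_texture_of_charge`) — the forest class is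
uniform at node charge `0.5443`, with no test.  The law of record charges `½`; there the per-texture
azimuth test of `rung_superTree_texture` is needed instead.
WHAT THIS IS NOT: the law of record; inclined junctions between nodes; the crux is not claimed.
-/

noncomputable section

open scoped BigOperators InnerProductSpace ENNReal Pointwise
open MeasureTheory Filter Set

namespace Summit.Ventures.Crystal3D.Cruxes.PolycrystalWulffBound.PolyDensity

open Summit.Ventures.Crystal3D.Theorems
open Summit.Ventures.Crystal3D.Cruxes.TextureLiminf.TexShadow (per polytope facetArea supportFn E3
  PolytopeCalculus stub_polytopeCalculus)
open Literature.MathematicalPhysics.StatisticalMechanics (fccStacking barlowStacking IsHaggSeq perimeter)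

/-- **Rung `rung_superTree_texture_of_charge`**: a texture presented as a sorted tree of super-grains
whose slid nodes are joined through basal planes about their own axes, with the twin walls inside slid
nodes charged `≥ 4/(3√6)`, satisfies `6·2^{1/3}(√2·Vol)^{2/3} ≤ En` — no azimuth test. -/
theorem rung_superTree_texture_of_charge :
    let Λ : Set (EuclideanSpace ℝ (Fin 3)) := Literature.MathematicalPhysics.StatisticalMechanics.fccStacking 1 (Real.sqrt (2 / 3));
    let Brl : (ℤ → ℤ) → Set (EuclideanSpace ℝ (Fin 3)) := Literature.MathematicalPhysics.StatisticalMechanics.barlowStacking 1 (Real.sqrt (2 / 3));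
    let Ax : EuclideanSpace ℝ (Fin 3) → (EuclideanSpace ℝ (Fin 3) ≃ₗᵢ[ℝ] EuclideanSpace ℝ (Fin 3)) → (EuclideanSpace ℝ (Fin 3) ≃ₗᵢ[ℝ] EuclideanSpace ℝ (Fin 3)) → Prop := fun m A B => ∃ (L : EuclideanSpace ℝ (Fin 3) ≃ₗᵢ[ℝ] EuclideanSpace ℝ (Fin 3)) (s₁ s₂ : EuclideanSpace ℝ (Fin 3)) (σ σ' : ℤ → ℤ), Literature.MathematicalPhysics.StatisticalMechanics.IsHaggSeq σ ∧ Literature.MathematicalPhysics.StatisticalMechanics.IsHaggSeq σ' ∧ L (EuclideanSpace.single (2 : Fin 3) (1 : ℝ)) = m ∧ A '' Λ ⊆ (fun q => L q + s₁) '' Brl σ ∧ B '' Λ ⊆ (fun q => L q + s₂) '' Brl σ';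
    let CoAx : (EuclideanSpace ℝ (Fin 3) ≃ₗᵢ[ℝ] EuclideanSpace ℝ (Fin 3)) → (EuclideanSpace ℝ (Fin 3) ≃ₗᵢ[ℝ] EuclideanSpace ℝ (Fin 3)) → Prop := fun A B => ∃ m, Ax m A B;
    let Φ : EuclideanSpace ℝ (Fin 3) → ℝ := fun ν => Real.sqrt 2 / 4 * ∑ᶠ w ∈ {w ∈ Λ | ‖w‖ = 1}, |⟪w, ν⟫_ℝ|;
    let Per : Set (EuclideanSpace ℝ (Fin 3)) → Set (EuclideanSpace ℝ (Fin 3)) → ℝ := fun K S => (⨆ (ξ : EuclideanSpace ℝ (Fin 3) → EuclideanSpace ℝ (Fin 3)) (_ : ContDiff ℝ 1 ξ ∧ HasCompactSupport ξ ∧ ∀ z, ξ z ∈ K), ENNReal.ofReal (∫ z in S, Literature.MathematicalPhysics.StatisticalMechanics.fieldDivergence ξ z)).toReal;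
    let ι : Set (EuclideanSpace ℝ (Fin 3)) → Set (EuclideanSpace ℝ (Fin 3)) → Set (EuclideanSpace ℝ (Fin 3)) → ℝ := fun K S₁ S₂ => (Per K S₁ + Per K S₂ - Per K (S₁ ∪ S₂)) / 2;
    let W : (EuclideanSpace ℝ (Fin 3) ≃ₗᵢ[ℝ] EuclideanSpace ℝ (Fin 3)) → Set (EuclideanSpace ℝ (Fin 3)) := fun A => {y | ∀ ν : EuclideanSpace ℝ (Fin 3), ⟪y, ν⟫_ℝ ≤ Φ (A.symm ν)};
    let Dsc : EuclideanSpace ℝ (Fin 3) → Set (EuclideanSpace ℝ (Fin 3)) := fun m => {y | ‖y‖ ≤ 1 ∧ ⟪y, m⟫_ℝ = 0};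
    let Tex : (n : ℕ) → (Fin n → Set (EuclideanSpace ℝ (Fin 3))) → (Fin n → (EuclideanSpace ℝ (Fin 3) ≃ₗᵢ[ℝ] EuclideanSpace ℝ (Fin 3))) → (Fin n → Fin n → ℝ) → (Fin n → Fin n → EuclideanSpace ℝ (Fin 3)) → Prop := fun n G A c m => (∀ f : Fin n, Literature.MathematicalPhysics.StatisticalMechanics.HasFinitePerimeter (G f) ∧ volume (G f) < ⊤) ∧ (∀ f g, f ≠ g → Disjoint (G f) (G g)) ∧ (∀ f g, f ≠ g → 0 ≤ c f g) ∧ (∀ f g, f ≠ g → ¬ CoAx (A f) (A g) → m f g = 0 ∧ 1 ≤ c f g) ∧ (∀ f g, f ≠ g → CoAx (A f) (A g) → A f '' Λ ≠ A g '' Λ → Ax (m f g) (A f) (A g) ∧ 1 / 2 ≤ c f g);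
    let En : (n : ℕ) → (Fin n → Set (EuclideanSpace ℝ (Fin 3))) → (Fin n → (EuclideanSpace ℝ (Fin 3) ≃ₗᵢ[ℝ] EuclideanSpace ℝ (Fin 3))) → (Fin n → Fin n → ℝ) → (Fin n → Fin n → EuclideanSpace ℝ (Fin 3)) → ℝ := fun n G A c m => ∑ f : Fin n, Per (W (A f)) (G f) - ∑ f, ∑ g, (if f = g then 0 else ι (W (A f)) (G f) (G g)) + ∑ f, ∑ g, (if f = g then 0 else c f g / 2 * ι (Dsc (m f g)) (G f) (G g));
    let Vol : (n : ℕ) → (Fin n → Set (EuclideanSpace ℝ (Fin 3))) → ℝ := fun n G => (volume (⋃ f : Fin n, G f)).toReal;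
    ∀ (k' : ℕ) (Hc : Fin k' → Finset ((EuclideanSpace ℝ (Fin 3)) × ℝ)) (nv : Fin k' → Fin k' → EuclideanSpace ℝ (Fin 3)),
      (∀ j, Bornology.IsBounded (polytope (Hc j))) →
      (∀ j j', j ≠ j' → Disjoint (polytope (Hc j)) (polytope (Hc j'))) →
      (∀ i j, nv j i = -nv i j) →
      (∀ j j', j ≠ j' → ‖nv j j'‖ = 1 ∧ ∃ b : ℝ,
        closure (polytope (Hc j)) ∩ closure (polytope (Hc j')) ⊆ {x | ⟪nv j j', x⟫_ℝ = b}) →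
    ∀ (n : ℕ) (G : Fin n → Set (EuclideanSpace ℝ (Fin 3)))
      (A : Fin n → (EuclideanSpace ℝ (Fin 3) ≃ₗᵢ[ℝ] EuclideanSpace ℝ (Fin 3)))
      (c : Fin n → Fin n → ℝ) (m : Fin n → Fin n → EuclideanSpace ℝ (Fin 3)),
      Tex n G A c m →
    ∀ (s : Fin n → Finset (Fin k')),
      (∀ f, G f = ⋃ j ∈ s f, polytope (Hc j)) →
      (∀ f g, f ≠ g → Disjoint (s f) (s g)) →
      (∀ j, ∃ f, j ∈ s f) →
    ∀ (τ : Fin n → Bool) (N : ℕ) (par : Fin N → Fin (N + 1)) (nrm : Fin N → EuclideanSpace ℝ (Fin 3))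
      (thr : Fin N → ℝ) (nd : Fin n → Fin (N + 1))
      (Aref : Fin (N + 1) → (EuclideanSpace ℝ (Fin 3) ≃ₗᵢ[ℝ] EuclideanSpace ℝ (Fin 3)))
      (slid : Fin (N + 1) → Bool) (mS uS wS : Fin (N + 1) → EuclideanSpace ℝ (Fin 3)) (δ : ℝ),
      (∀ i, (par i : ℕ) ≤ i) → (∀ i, ‖nrm i‖ = 1) →
      (∀ i (t : ℝ), volume (W (Aref i.succ) ∩ {y | t < ⟪y, nrm i⟫_ℝ}) =
        volume (W (Aref (par i)) ∩ {y | t < ⟪y, nrm i⟫_ℝ})) →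
      (∀ i f, nd f = i.succ → ∀ x ∈ G f, thr i < ⟪x, nrm i⟫_ℝ) → 0 < δ →
      (∀ i f, nd f = par i → ∀ x ∈ G f,
        ⟪x, nrm i⟫_ℝ < thr i ∨ ∀ g, nd g = i.succ → ∀ y ∈ G g, δ ≤ dist x y) →
      (∀ f g, nd f ≠ nd g → (∀ i, ¬ (nd f = par i ∧ nd g = i.succ)) →
        (∀ i, ¬ (nd g = par i ∧ nd f = i.succ)) → ∀ x ∈ G f, ∀ y ∈ G g, δ ≤ dist x y) →
      (∀ f, slid (nd f) = false → W (A f) = W (Aref (nd f))) →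
      (∀ f, slid (nd f) = true → Ax (mS (nd f)) (Aref (nd f)) (A f)) →
      (∀ f g, nd f = nd g → slid (nd f) = true → Ax (mS (nd f)) (A f) (A g)) →
      (∀ F, slid F = true → ‖uS F‖ = 1 ∧ ‖wS F‖ = 1 ∧ ⟪uS F, mS F⟫_ℝ = 0 ∧ ⟪wS F, mS F⟫_ℝ = 0 ∧
        ⟪wS F, uS F⟫_ℝ = 0) →
      (∀ F, slid F = true → uS F ∈ Aref F '' Λ ∧ (ℝ ∙ uS F)ᗮ.reflection '' (Aref F '' Λ) = Aref F '' Λ) →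
    ∀ (u₂S w₂S u₃S w₃S : Fin (N + 1) → EuclideanSpace ℝ (Fin 3)),
      (∀ F, slid F = true → w₂S F = (Real.sqrt 3 / 2) • uS F - (1 / 2 : ℝ) • wS F ∧
        w₃S F = -(Real.sqrt 3 / 2) • uS F - (1 / 2 : ℝ) • wS F) →
      (∀ F, slid F = true → ‖u₂S F‖ = 1 ∧ ⟪u₂S F, mS F⟫_ℝ = 0 ∧ ⟪w₂S F, u₂S F⟫_ℝ = 0) →
      (∀ F, slid F = true → u₂S F ∈ Aref F '' Λ ∧ (ℝ ∙ u₂S F)ᗮ.reflection '' (Aref F '' Λ) = Aref F '' Λ) →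
      (∀ F, slid F = true → ‖u₃S F‖ = 1 ∧ ⟪u₃S F, mS F⟫_ℝ = 0 ∧ ⟪w₃S F, u₃S F⟫_ℝ = 0) →
      (∀ F, slid F = true → u₃S F ∈ Aref F '' Λ ∧ (ℝ ∙ u₃S F)ᗮ.reflection '' (Aref F '' Λ) = Aref F '' Λ) →
      (∀ f g, nd f = nd g → (τ f = τ g ↔ A f '' Λ = A g '' Λ)) →
      (∀ f g, f ≠ g → nd f = nd g → slid (nd f) = true → τ f ≠ τ g → m f g = mS (nd f)) →
      (∀ i, slid (par i) = true → ⟪nrm i, wS (par i)⟫_ℝ = 0 ∧ ⟪nrm i, uS (par i)⟫_ℝ = 0) →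
      (∀ i, slid i.succ = true → ⟪nrm i, wS i.succ⟫_ℝ = 0 ∧ ⟪nrm i, uS i.succ⟫_ℝ = 0) →
      (∀ f g, f ≠ g → nd f = nd g → slid (nd f) = true → τ f ≠ τ g → 4 / (3 * Real.sqrt 6) ≤ c f g) →
    6 * (2 : ℝ) ^ ((1 : ℝ) / 3) * (Real.sqrt 2 * Vol n G) ^ ((2 : ℝ) / 3) ≤ En n G A c m := by
  intro Λ Brl Ax CoAx Φ Per ι W Dsc Tex En Vol k' Hc nv hbd hdisjQ hanti hplane n G A c m hTex
    s hGs hsdisj hcov τ N par nrm thr nd Aref slid mS uS wS δ hpar hn1 hprof hGt hδ hPt hfar hN1 hN2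
    hAxP hON hBM u₂S w₂S u₃S w₃S hW23 hON2 hBM2 hON3 hBM3 hτ hmax hNa hNb hc
  classical
  have hTex' := hTex
  obtain ⟨hfin, hdisjG, hc0, -, htwin⟩ := hTex'
  have hvol : ∀ f, volume (G f) < ⊤ := fun f => (hfin f).2
  have hPC := stub_polytopeCalculus
  have hmS : ∀ f, slid (nd f) = true → ‖mS (nd f)‖ = 1 := by
    intro f hf
    obtain ⟨L, -, -, -, -, -, -, hLm, -, -⟩ := hN2 f hf
    rw [← hLm, LinearIsometryEquiv.norm_map, PiLp.norm_single, norm_one]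
  -- the two other `⟨112⟩` directions of each slid node: unit, horizontal
  have h3 : Real.sqrt 3 ^ 2 = 3 := Real.sq_sqrt (by norm_num)
  have hnormw : ∀ F, slid F = true → ∀ (ε : ℝ), ε = 1 ∨ ε = -1 →
      ‖(ε * (Real.sqrt 3 / 2)) • uS F - (1 / 2 : ℝ) • wS F‖ = 1 ∧
      ⟪(ε * (Real.sqrt 3 / 2)) • uS F - (1 / 2 : ℝ) • wS F, mS F⟫_ℝ = 0 := by
    intro F hF ε hε
    obtain ⟨hu, hw, hum, hwm, hwu⟩ := hON F hF
    have huu : ⟪uS F, uS F⟫_ℝ = 1 := by rw [real_inner_self_eq_norm_sq, hu, one_pow]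
    have hww : ⟪wS F, wS F⟫_ℝ = 1 := by rw [real_inner_self_eq_norm_sq, hw, one_pow]
    have huw : ⟪uS F, wS F⟫_ℝ = 0 := by rw [real_inner_comm]; exact hwu
    have hε2 : ε ^ 2 = 1 := by rcases hε with h | h <;> rw [h] <;> norm_num
    constructor
    · have hsq : ‖(ε * (Real.sqrt 3 / 2)) • uS F - (1 / 2 : ℝ) • wS F‖ ^ 2 = 1 := by
        rw [← real_inner_self_eq_norm_sq, inner_sub_left, inner_sub_right, inner_sub_right,
          real_inner_smul_left, real_inner_smul_left, real_inner_smul_right, real_inner_smul_right,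
          real_inner_smul_left, real_inner_smul_right, real_inner_smul_left, real_inner_smul_right,
          huu, hww, huw, hwu]
        nlinarith [h3, hε2]
      nlinarith [norm_nonneg ((ε * (Real.sqrt 3 / 2)) • uS F - (1 / 2 : ℝ) • wS F), hsq]
    · rw [inner_sub_left, real_inner_smul_left, real_inner_smul_left, hum, hwm, mul_zero, mul_zero,
        sub_zero]
  have hw₂ : ∀ F, slid F = true → ‖w₂S F‖ = 1 ∧ ⟪w₂S F, mS F⟫_ℝ = 0 := by
    intro F hF
    have e : w₂S F = (1 * (Real.sqrt 3 / 2)) • uS F - (1 / 2 : ℝ) • wS F := by rw [(hW23 F hF).1, one_mul]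
    rw [e]; exact hnormw F hF 1 (Or.inl rfl)
  have hw₃ : ∀ F, slid F = true → ‖w₃S F‖ = 1 ∧ ⟪w₃S F, mS F⟫_ℝ = 0 := by
    intro F hF
    have e : w₃S F = (-1 * (Real.sqrt 3 / 2)) • uS F - (1 / 2 : ℝ) • wS F := by
      rw [(hW23 F hF).2, neg_one_mul, neg_smul]
    rw [e]; exact hnormw F hF (-1) (Or.inr rfl)
  -- edge normals are `⊥` all three directions
  have hperp23 : ∀ F (v : E3), slid F = true → ⟪v, wS F⟫_ℝ = 0 → ⟪v, uS F⟫_ℝ = 0 →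
      ⟪v, w₂S F⟫_ℝ = 0 ∧ ⟪v, w₃S F⟫_ℝ = 0 := by
    intro F v hF h1 h2
    rw [(hW23 F hF).1, (hW23 F hF).2]
    constructor <;>
    · simp only [inner_sub_right, real_inner_smul_right, inner_neg_right, neg_smul, h1, h2, mul_zero,
        neg_zero, sub_zero]
  -- abbreviations: facet areas, the per-pair budgets
  set fa : Fin k' → Fin k' → ℝ := fun a b =>
    facetArea (closure (polytope (Hc a)) ∩ closure (polytope (Hc b))) (nv a b) with hfa
  have hfa0 : ∀ a b, 0 ≤ fa a b := fun a b => ENNReal.toReal_nonneg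
  set φ : E3 → Fin n → Fin n → ℝ := fun v f g =>
    if (nd f = nd g ∧ slid (nd f) = true ∧ τ f ≠ τ g) then
      ∑ a ∈ s f, ∑ b ∈ s g, |⟪v, nv a b⟫_ℝ| * fa a b else 0 with hφ
  set ψ : Fin n → Fin n → ℝ := fun f g =>
    if (nd f = nd g ∧ slid (nd f) = true ∧ τ f ≠ τ g) then
      ∑ a ∈ s f, ∑ b ∈ s g, Real.sqrt (1 - ⟪nv a b, mS (nd f)⟫_ℝ ^ 2) * fa a b else 0 with hψ
  have hφ0 : ∀ v f g, 0 ≤ φ v f g := by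
    intro v f g; simp only [hφ]; split_ifs
    · exact Finset.sum_nonneg fun a _ => Finset.sum_nonneg fun b _ => mul_nonneg (abs_nonneg _) (hfa0 a b)
    · exact le_rfl
  have hψ0 : ∀ f g, 0 ≤ ψ f g := by
    intro f g; simp only [hψ]; split_ifs
    · exact Finset.sum_nonneg fun a _ => Finset.sum_nonneg fun b _ =>
        mul_nonneg (Real.sqrt_nonneg _) (hfa0 a b)
    · exact le_rfl
  have hφψ : ∀ f g, φ (wS (nd f)) f g + φ (w₂S (nd f)) f g + φ (w₃S (nd f)) f g ≤ 2 * ψ f g := by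
    intro f g
    by_cases hfg : nd f = nd g ∧ slid (nd f) = true ∧ τ f ≠ τ g
    · simp only [hφ, hψ, if_pos hfg]
      have hne : f ≠ g := fun h => hfg.2.2 (h ▸ rfl)
      obtain ⟨hu, hw, hum, hwm, hwu⟩ := hON (nd f) hfg.2.1
      have hthree := three_dir_abs_sum_le hu hw (hmS f hfg.2.1) hum hwm hwu (hW23 (nd f) hfg.2.1).1
        (hW23 (nd f) hfg.2.1).2
      rw [← Finset.sum_add_distrib, ← Finset.sum_add_distrib, Finset.mul_sum]
      refine Finset.sum_le_sum fun a ha => ?_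
      rw [← Finset.sum_add_distrib, ← Finset.sum_add_distrib, Finset.mul_sum]
      refine Finset.sum_le_sum fun b hb => ?_
      have hab : a ≠ b := fun h => Finset.disjoint_left.1 (hsdisj f g hne) ha (h ▸ hb)
      have hν : ‖nv a b‖ = 1 := (hplane a b hab).1
      have h := mul_le_mul_of_nonneg_right (hthree (nv a b) hν) (hfa0 a b)
      linarith only [h]
    · simp only [hφ, hψ, if_neg hfg]; norm_num
  -- node budgets and the per-node choice of the direction
  set NB : E3 → Fin (N + 1) → ℝ := fun v F =>
    ∑ f ∈ Finset.univ.filter (fun f => nd f = F), ∑ g, φ v f g with hNB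
  set Wst : Fin (N + 1) → E3 := fun F =>
    if NB (wS F) F ≤ NB (w₂S F) F ∧ NB (wS F) F ≤ NB (w₃S F) F then wS F
    else if NB (w₂S F) F ≤ NB (w₃S F) F then w₂S F else w₃S F with hWst
  set Ust : Fin (N + 1) → E3 := fun F =>
    if NB (wS F) F ≤ NB (w₂S F) F ∧ NB (wS F) F ≤ NB (w₃S F) F then uS F
    else if NB (w₂S F) F ≤ NB (w₃S F) F then u₂S F else u₃S F with hUst
  -- the chosen pair satisfies every hypothesis of the free rung
  have hcases : ∀ F, (Wst F = wS F ∧ Ust F = uS F) ∨ (Wst F = w₂S F ∧ Ust F = u₂S F) ∨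
      (Wst F = w₃S F ∧ Ust F = u₃S F) := by
    intro F
    simp only [hWst, hUst]
    split_ifs
    · exact Or.inl ⟨rfl, rfl⟩
    · exact Or.inr (Or.inl ⟨rfl, rfl⟩)
    · exact Or.inr (Or.inr ⟨rfl, rfl⟩)
  have hONst : ∀ F, slid F = true → ‖Ust F‖ = 1 ∧ ‖Wst F‖ = 1 ∧ ⟪Ust F, mS F⟫_ℝ = 0 ∧
      ⟪Wst F, mS F⟫_ℝ = 0 ∧ ⟪Wst F, Ust F⟫_ℝ = 0 := by
    intro F hF
    rcases hcases F with ⟨h1, h2⟩ | ⟨h1, h2⟩ | ⟨h1, h2⟩ <;> rw [h1, h2]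
    · exact hON F hF
    · exact ⟨(hON2 F hF).1, (hw₂ F hF).1, (hON2 F hF).2.1, (hw₂ F hF).2, (hON2 F hF).2.2⟩
    · exact ⟨(hON3 F hF).1, (hw₃ F hF).1, (hON3 F hF).2.1, (hw₃ F hF).2, (hON3 F hF).2.2⟩
  have hBMst : ∀ F, slid F = true → Ust F ∈ Aref F '' Λ ∧
      (ℝ ∙ Ust F)ᗮ.reflection '' (Aref F '' Λ) = Aref F '' Λ := by
    intro F hF
    rcases hcases F with ⟨-, h2⟩ | ⟨-, h2⟩ | ⟨-, h2⟩ <;> rw [h2]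
    exacts [hBM F hF, hBM2 F hF, hBM3 F hF]
  have hNst : ∀ F (v : E3), slid F = true → ⟪v, wS F⟫_ℝ = 0 → ⟪v, uS F⟫_ℝ = 0 → ⟪v, Wst F⟫_ℝ = 0 := by
    intro F v hF h1 h2
    rcases hcases F with ⟨h, -⟩ | ⟨h, -⟩ | ⟨h, -⟩ <;> rw [h]
    exacts [h1, (hperp23 F v hF h1 h2).1, (hperp23 F v hF h1 h2).2]
  have R := rung_superTree_texture_free k' Hc nv hbd hdisjQ hanti hplane n G A c m hTex s hGs hsdisj hcov
    τ N par nrm thr nd Aref slid mS Ust Wst δ hpar hn1 hprof hGt hδ hPt hfar hN1 hN2 hONst hBMst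
    (fun f g h h' => (hτ f g h).1 h')
    (fun i hi => hNst _ _ hi (hNa i hi).1 (hNa i hi).2) (fun i hi => hNst _ _ hi (hNb i hi).1 (hNb i hi).2)
  -- the chosen budget is at most the average of the three
  have hmin : ∀ F, NB (Wst F) F ≤ (NB (wS F) F + NB (w₂S F) F + NB (w₃S F) F) / 3 := by
    intro F
    have hNB0 : ∀ v, 0 ≤ NB v F := fun v =>
      Finset.sum_nonneg fun f _ => Finset.sum_nonneg fun g _ => hφ0 v f g
    simp only [hWst]
    split_ifs with hc1 hc2
    · linarith [hc1.1, hc1.2]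
    · rcases not_and_or.1 hc1 with h | h
      · have h' := not_le.1 h; linarith
      · have h' := not_le.1 h; linarith
    · have h2 := not_le.1 hc2
      rcases not_and_or.1 hc1 with h | h
      · have h' := not_le.1 h; linarith
      · have h' := not_le.1 h; linarith
  have hbudget : ∑ f, ∑ g, φ (Wst (nd f)) f g ≤ (2 / 3 : ℝ) * ∑ f, ∑ g, ψ f g := by
    have hmaps : ∀ f ∈ (Finset.univ : Finset (Fin n)), nd f ∈ (Finset.univ : Finset (Fin (N + 1))) :=
      fun f _ => Finset.mem_univ _
    have e1 : ∑ f, ∑ g, φ (Wst (nd f)) f g = ∑ F, NB (Wst F) F := by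
      rw [← Finset.sum_fiberwise_of_maps_to hmaps]
      refine Finset.sum_congr rfl fun F _ => Finset.sum_congr rfl fun f hf => ?_
      rw [(Finset.mem_filter.1 hf).2]
    have e2 : ∀ v : Fin (N + 1) → E3, ∑ F, NB (v F) F = ∑ f, ∑ g, φ (v (nd f)) f g := by
      intro v
      rw [← Finset.sum_fiberwise_of_maps_to hmaps]
      refine Finset.sum_congr rfl fun F _ => Finset.sum_congr rfl fun f hf => ?_
      rw [(Finset.mem_filter.1 hf).2]
    rw [e1]
    calc ∑ F, NB (Wst F) F ≤ ∑ F, (NB (wS F) F + NB (w₂S F) F + NB (w₃S F) F) / 3 :=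
          Finset.sum_le_sum fun F _ => hmin F
      _ = ((∑ F, NB (wS F) F) + (∑ F, NB (w₂S F) F) + ∑ F, NB (w₃S F) F) / 3 := by
          rw [← Finset.sum_add_distrib, ← Finset.sum_add_distrib, Finset.sum_div]
      _ = (∑ f, ∑ g, (φ (wS (nd f)) f g + φ (w₂S (nd f)) f g + φ (w₃S (nd f)) f g)) / 3 := by
          rw [e2 wS, e2 w₂S, e2 w₃S]
          simp only [Finset.sum_add_distrib]
      _ ≤ (∑ f, ∑ g, 2 * ψ f g) / 3 := by
          gcongr with f _ g _
          exact hφψ f g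
      _ = (2 / 3 : ℝ) * ∑ f, ∑ g, ψ f g := by
          rw [Finset.mul_sum, Finset.sum_div]
          refine Finset.sum_congr rfl fun f _ => ?_
          rw [Finset.mul_sum, Finset.sum_div]
          refine Finset.sum_congr rfl fun g _ => ?_
          ring
  -- the walls of the texture pay `2/(3√6)·ψ`
  have hwall : ∀ f g, 2 / (3 * Real.sqrt 6) * ψ f g ≤
      (if f = g then 0 else c f g / 2 * ι (Dsc (m f g)) (G f) (G g)) := by
    intro f g
    by_cases hfg : f = g
    · subst hfg; simp [hψ]
    · rw [if_neg hfg]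
      have hDc : IsCompact (Dsc (m f g)) :=
        Metric.isCompact_of_isClosed_isBounded
          ((isClosed_le continuous_norm continuous_const).inter
            (isClosed_eq (continuous_id.inner continuous_const) continuous_const))
          (Metric.isBounded_closedBall.subset (cruxDisc_subset_closedBall (m f g)))
      have hι0 : 0 ≤ ι (Dsc (m f g)) (G f) (G g) := by
        show 0 ≤ (Per (Dsc (m f g)) (G f) + Per (Dsc (m f g)) (G g) - Per (Dsc (m f g)) (G f ∪ G g)) / 2
        have h := iota_nonneg_of_poly G (fun f => by
            rw [hGs]; exact ⟨(s f).card, fun i => Hc ((s f).equivFin.symm i), by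
              ext x; simp only [mem_iUnion, exists_prop]
              constructor
              · rintro ⟨j, hj, hx⟩; exact ⟨(s f).equivFin ⟨j, hj⟩, by simpa using hx⟩
              · rintro ⟨i, hx⟩; exact ⟨_, ((s f).equivFin.symm i).2, hx⟩⟩)
          hvol hdisjG hDc (convex_cruxDisc (m f g)) (zero_mem_cruxDisc (m f g)) hfg
        exact div_nonneg h (by norm_num)
      by_cases hτfg : nd f = nd g ∧ slid (nd f) = true ∧ τ f ≠ τ g
      · simp only [hψ, if_pos hτfg]
        have hmfg : m f g = mS (nd f) := hmax f g hfg hτfg.1 hτfg.2.1 hτfg.2.2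
        have hcfg : 4 / (3 * Real.sqrt 6) ≤ c f g := hc f g hfg hτfg.1 hτfg.2.1 hτfg.2.2
        have hιlow : ∑ a ∈ s f, ∑ b ∈ s g, Real.sqrt (1 - ⟪nv a b, mS (nd f)⟫_ℝ ^ 2) * fa a b ≤
            ι (Dsc (mS (nd f))) (G f) (G g) := by
          have h := sinSum_le_iota_of_polytopeCalculus hPC (hmS f hτfg.2.1) Hc nv hbd hdisjQ hanti
            hplane (hsdisj f g hfg)
          have e1 : (⋃ j ∈ s f, polytope (Hc j)) = G f := (hGs f).symm
          have e2 : (⋃ j ∈ s g, polytope (Hc j)) = G g := (hGs g).symm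
          have e3 : (⋃ j ∈ s f ∪ s g, polytope (Hc j)) = G f ∪ G g := by
            rw [Finset.set_biUnion_union, e1, e2]
          rw [e1, e2, e3] at h
          exact h
        rw [hmfg] at hι0 ⊢
        have hZfg0 := hψ0 f g
        simp only [hψ, if_pos hτfg] at hZfg0
        have e : 2 / (3 * Real.sqrt 6) = (4 / (3 * Real.sqrt 6)) / 2 := by ring
        rw [e]
        have p1 := mul_le_mul_of_nonneg_left hιlow (show (0:ℝ) ≤ 4 / (3 * Real.sqrt 6) / 2 by positivity)
        have p2 := mul_le_mul_of_nonneg_right hcfg hι0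
        linarith only [p1, p2]
      · simp only [hψ, if_neg hτfg, mul_zero]
        exact mul_nonneg (div_nonneg (hc0 f g hfg) (by norm_num)) hι0
  have hwallsum : 2 / (3 * Real.sqrt 6) * ∑ f, ∑ g, ψ f g ≤
      ∑ f, ∑ g, (if f = g then 0 else c f g / 2 * ι (Dsc (m f g)) (G f) (G g)) := by
    rw [Finset.mul_sum]
    refine Finset.sum_le_sum fun f _ => ?_
    rw [Finset.mul_sum]
    exact Finset.sum_le_sum fun g _ => hwall f g
  -- assemble
  show 6 * (2 : ℝ) ^ ((1 : ℝ) / 3) * (Real.sqrt 2 * (volume (⋃ f, G f)).toReal) ^ ((2 : ℝ) / 3) ≤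
    ∑ f, Per (W (A f)) (G f) - ∑ f, ∑ g, (if f = g then 0 else ι (W (A f)) (G f) (G g)) +
      ∑ f, ∑ g, (if f = g then 0 else c f g / 2 * ι (Dsc (m f g)) (G f) (G g))
  have R' : 6 * (2 : ℝ) ^ ((1 : ℝ) / 3) * (Real.sqrt 2 * (volume (⋃ f, G f)).toReal) ^ ((2 : ℝ) / 3) ≤
      (∑ f, Per (W (A f)) (G f) - ∑ f, ∑ g, (if f = g then 0 else ι (W (A f)) (G f) (G g))) +
        1 / Real.sqrt 6 * ∑ f, ∑ g, φ (Wst (nd f)) f g := R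
  have h6 : (0 : ℝ) < Real.sqrt 6 := Real.sqrt_pos.2 (by norm_num)
  have hkey : 1 / Real.sqrt 6 * ∑ f, ∑ g, φ (Wst (nd f)) f g ≤ 2 / (3 * Real.sqrt 6) * ∑ f, ∑ g, ψ f g := by
    have e : 2 / (3 * Real.sqrt 6) * ∑ f, ∑ g, ψ f g = 1 / Real.sqrt 6 * ((2 / 3 : ℝ) * ∑ f, ∑ g, ψ f g) := by
      ring
    rw [e]
    exact mul_le_mul_of_nonneg_left hbudget (by positivity)
  linarith only [R', hkey, hwallsum]

end Summit.Ventures.Crystal3D.Cruxes.PolycrystalWulffBound.PolyDensity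

end
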